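import Literature.Analysis.FluidPDE.TaoClassGlue
import Literature.Analysis.FluidPDE.AxisymmetricEuler
import HarnessLib

/-!
# Named fact: Ladyzhenskaya's a-priori enstrophy bound for axisymmetric flows without swirl

Analysis/FluidPDE facts file (D-0014 named fact, nothing asserted) for the decomposition of
`Literature.Analysis.FluidPDE.axisymmetric_no_swirl_global_regularity` (`Axisymmetric.lean`;
Ladyzhenskaya 1968, Ukhovskii–Yudovich 1968: axisymmetric Navier–Stokes flows without swirl
from regular data are global), following the held source

* P. G. Lemarié-Rieusset, *The Navier–Stokes Problem in the 21st Century*, CRC Press (2016),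
  §10.3, Theorem 10.4 (held copy p. 285) and its proof (pp. 285–289), "the very simple proof
  proposed by Leonardi, Málek, Nečas, and Pokorný [326]".

## The printed argument (Thm. 10.4, proof, pp. 285–289; `f = 0`)

Let `u` be the `H²` mild solution (Thm. 7.3), locally in time in `L^∞_t H² ∩ L²_t H³`,
axisymmetric without swirl, `ω = curl u = ω_θ e_θ` ((10.21)–(10.22)). Then
(p. 284) `‖u‖_{Ḣ¹} ≃ ‖ω‖₂`, `‖u‖_{Ḣ²} ≃ ‖∇ ⊗ ω‖₂` with
`|∇ ⊗ ω|² = |∂ᵣω_θ|² + |∂_zω_θ|² + ω_θ²/r²` (p. 286);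
**Ladyzhenskaya's key observation** (10.25)–(10.27): `∫ |ω(t)|² r⁻² dx ≤ ‖ω₀‖²_{Ḣ¹}`
for all `t` (proved with the regularised weights `r^η α_ε(r) r⁻²` of [326], (10.26));
and the enstrophy balance (p. 289)
`∂ₜ‖ω‖₂² = −2ν‖ω‖²_{Ḣ¹} + 2∫ uᵣ ω_θ² r⁻¹ dx ≤ −ν‖ω‖²_{Ḣ¹} + ‖uᵣ‖_∞ ‖ω‖₂ ‖ω/r‖₂²`,
`‖uᵣ‖_∞ ≤ C ‖ω‖₂^{1/2} ‖ω‖_{Ḣ¹}^{1/2}`, whence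
`∂ₜ‖ω‖₂² ≤ C ν^{−1/3} ‖ω‖₂² ‖ω/r‖₂^{4/3}`; "We then conclude by Grönwall's lemma and (10.27)
that `‖ω‖₂` remains bounded" — explicitly `‖ω(t)‖₂² ≤ ‖ω₀‖₂² exp(C ν^{−1/3} ‖ω₀‖_{Ḣ¹}^{4/3} t)`.
This a-priori bound of `‖u(t)‖_{Ḣ¹}` on bounded time intervals, by a constant depending only
on `ν`, the length of the interval and `‖ω₀‖₂`, `‖∇ω₀‖₂`, is the analytic heart of Thm. 10.4;
the rest (local theory with blow-up alternative, Thm. 7.3; symmetry preservation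
(10.20)–(10.21)) is in the tree (`tao2011_smooth_local_existence`, `TaoClassGlue.lean`,
`AxisymmetricReflection.lean`) and the assembly is carried out downstream
(`AxisymmetricNoSwirlGlobal*.lean`).

## Rendering

The fact is stated for the **smooth class in which the tree runs continuation arguments**,
`IsTaoSolutionOn T ν u₀ u p` (`TaoClassGlue.lean`: classical solution on the closed slab
`[0, T] × ℝ³` with `u, ∂ₜu, p ∈ L^∞_t H^k_x` for all `k` and `u ∈ C([0, T]; L²)`; Tao 2013,
Thm. 5.4), which is contained in the book's class `L^∞_t H² ∩ L²_t H³` — so the statement below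
is a special case of what the printed proof establishes, never stronger. Norms are the tree's
currency `∫⁻ ‖iteratedFDeriv ℝ n v x‖ₑ²` (operator norms of the Fréchet derivatives; for
divergence-free `v`, `∫ |∇v|² = ∫ |ω|²`, and all finite-dimensional norm choices only move the
unspecified constants), axisymmetry and no swirl are the accepted `Fluid.IsAxisymmetric`,
`Fluid.HasNoSwirl`, assumed at every time of the slab (their propagation from the datum is
proved separately, so assuming them costs nothing and keeps the fact weaker). The bound `K` is
existential, depending only on `(ν, T, E₀, G₀, H₀)` — the viscosity, the length of the time
interval and bounds for `‖u₀‖₂²`, `‖Du₀‖₂²`, `‖D²u₀‖₂²` — and is uniform over all slabs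
`[0, T'] ⊆ [0, T]` and all solutions with such data; the printed bound is the explicit,
`E₀`-independent, increasing-in-`t` function above, which gives such a `K` a fortiori.

Nothing is asserted; users take `(h : axisymmetricNoSwirl_enstrophy_apriori)`.

## Mathlib / tree search

`lean search 'no_swirl|NoSwirl|enstrophy_apriori|Ladyzhenskaya'`: the tree has the target
statement `axisymmetric_no_swirl_global_regularity`, the KNSS Liouville facts for swirl-free
ancient solutions (`knss2009_axisymmetric_no_swirl`, `KNSSAxisymmetricNoSwirl.lean`) and the
enstrophy inequality under an `L^∞` bound (`EnstrophyGronwall.lean`, Lemarié-Rieusset Thm. 11.2);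
no weighted (`r⁻²`) enstrophy estimate. Mathlib has no Navier–Stokes theory.

## References

* P. G. Lemarié-Rieusset, *The Navier–Stokes Problem in the 21st Century*, CRC Press 2016,
  Thm. 10.4 (held copy p. 285), proof pp. 285–289: (10.23), (10.25)–(10.27) and the final
  Grönwall step; Thm. 7.3 (p. 149). [LemarieRieusset2016]
* O. A. Ladyzhenskaya, *Unique solvability in the large of a three-dimensional Cauchy problem
  for the Navier–Stokes equations in the presence of axial symmetry*, Zap. Naučn. Sem. LOMI 7
  (1968), 155–177 (the book's [295]).
* M. R. Ukhovskii, V. I. Yudovich, *Axially symmetric flows of ideal and viscous fluids filling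
  the whole space*, J. Appl. Math. Mech. 32 (1968), 52–69 (the book's [486]).
* S. Leonardi, J. Málek, J. Nečas, M. Pokorný, *On axially symmetric flows in `ℝ³`*,
  Z. Anal. Anwendungen 18 (1999), 639–649 (the book's [326]).
* T. Tao, Anal. PDE 6 (2013) = arXiv:1108.1165, Thm. 5.4 (the class `IsTaoSolutionOn`).
-/

noncomputable section

open MeasureTheory Set
open scoped ENNReal

namespace Literature.Analysis.FluidPDE

/-- Local notation for physical space `ℝ³ = EuclideanSpace ℝ (Fin 3)`. -/
local notation "ℝ³" => EuclideanSpace ℝ (Fin 3)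

/-- **Ladyzhenskaya's a-priori enstrophy bound for axisymmetric Navier–Stokes flows without
swirl** (Lemarié-Rieusset 2016, Thm. 10.4, proof pp. 285–289, after Ladyzhenskaya 1968,
Ukhovskii–Yudovich 1968 and Leonardi–Málek–Nečas–Pokorný 1999). In print (`f = 0`): for the
regular solution `u ∈ L^∞_t H² ∩ L²_t H³` of Navier–Stokes with viscosity `ν > 0` which is
axisymmetric without swirl, `∫ |ω(t)|² r⁻² dx ≤ ‖ω₀‖²_{Ḣ¹}` ((10.27)) and
`∂ₜ‖ω‖₂² ≤ C ν^{−1/3} ‖ω‖₂² ‖ω/r‖₂^{4/3}` (p. 289), so that by Grönwall's lemma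
`‖ω(t)‖₂² ≤ ‖ω₀‖₂² exp(C ν^{−1/3} ‖∇ω₀‖₂^{4/3} t)`: "`‖ω‖₂` remains bounded" on every
bounded time interval, by a constant depending only on `ν`, the length of the interval,
`‖ω₀‖₂` and `‖∇ω₀‖₂`. Rendered for the tree's smooth continuation class (a sub-class of the
book's): for all `ν > 0`, `T > 0` and `E₀, G₀, H₀ ≥ 0` there is `K ≥ 0` such that for every
`0 < T' ≤ T` and every Tao-class solution `(u, p)` on `[0, T'] × ℝ³` from `u₀`
(`IsTaoSolutionOn T' ν u₀ u p`) which is axisymmetric without swirl at all times of `[0, T']`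
and has `∫ |u₀|² ≤ E₀`, `∫ ‖Du₀‖² ≤ G₀`, `∫ ‖D²u₀‖² ≤ H₀`, one has `∫ ‖Du(t)‖² ≤ K` for all
`t ∈ [0, T']` (for divergence-free fields `∫ |∇u|² = ∫ |ω|²`; operator norms of the Fréchet
derivatives, constants absorbed in `K`). Users take
`(h : axisymmetricNoSwirl_enstrophy_apriori)`. [cite: LemarieRieusset2016, Thm. 10.4 (p. 285), proof pp. 286–289: (10.25)–(10.27) and the final Grönwall step] -/
def axisymmetricNoSwirl_enstrophy_apriori : Prop :=
  ∀ ⦃ν T E₀ G₀ H₀ : ℝ⦄, 0 < ν → 0 < T → 0 ≤ E₀ → 0 ≤ G₀ → 0 ≤ H₀ →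
    ∃ K : ℝ, 0 ≤ K ∧ ∀ ⦃T' : ℝ⦄, 0 < T' → T' ≤ T →
      ∀ ⦃u₀ : ℝ³ → ℝ³⦄ ⦃u : ℝ → ℝ³ → ℝ³⦄ ⦃p : ℝ → ℝ³ → ℝ⦄, IsTaoSolutionOn T' ν u₀ u p →
        (∀ t ∈ Icc 0 T', IsAxisymmetric (u t)) → (∀ t ∈ Icc 0 T', HasNoSwirl (u t)) →
        ∫⁻ x, ‖u₀ x‖ₑ ^ 2 ≤ ENNReal.ofReal E₀ →
        ∫⁻ x, ‖iteratedFDeriv ℝ 1 u₀ x‖ₑ ^ 2 ≤ ENNReal.ofReal G₀ →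
        ∫⁻ x, ‖iteratedFDeriv ℝ 2 u₀ x‖ₑ ^ 2 ≤ ENNReal.ofReal H₀ →
        ∀ t ∈ Icc 0 T', ∫⁻ x, ‖iteratedFDeriv ℝ 1 (u t) x‖ₑ ^ 2 ≤ ENNReal.ofReal K

end Literature.Analysis.FluidPDE

end
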